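import Mathlib
import Literature.NumberTheory.Transcendental.KZCalculus
import Literature.NumberTheory.Transcendental.SemialgebraicMapsProofs
import Literature.NumberTheory.Transcendental.SemialgebraicLineDeriv
import Literature.NumberTheory.Transcendental.KZSemialgebraicComplex
import Summits.KontsevichZagierPeriods.KontsevichZagierPeriods.Theses.UnfoldedStokes

/-!
# `HyperellipticRiemannRelation` (stmt-KontsevichZagierPeriods-3522), line `SketchIdeator2`:
# stub `stub_boxReps` — the box representations exist

Registered stub `stub_boxReps` of the line skeleton. For the genus-2 curve
`y² = P(x) = ∏ⱼ (x − eⱼ)` (`e : Fin 5 → ℚ`) the ordered product integrand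
`f(x₀, x₁) = x₁ / √(|P(x₀)| |P(x₁)|)` is

* a `ℚ`-semialgebraic function on every `ℚ`-semialgebraic subset of `ℝ²`
  (`BoxReps.isSemialgebraicFunOn_integrand`): it is assembled from coordinates and rational
  constants by products, `|·|`, `√·` and `(·)⁻¹` (Mathlib's junk values included), all of which
  preserve semialgebraicity (Bochnak–Coste–Roy 1998, Prop. 2.2.6, proved in the tree:
  `SemialgebraicMapsProofs.lean`, `SemialgebraicLineDeriv.lean`);
* absolutely integrable on all of `ℝ²` (`BoxReps.integrable_integrand`): it is the tensor product
  `(1/√|P(x₀)|) · (x₁/√|P(x₁)|)` of two functions of one real variable, each dominated off the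
  finite branch set `E = {eⱼ}` (a Lebesgue-null set) by `C · m` with `m` the integrable weight of
  the kernel bounds — the hypothesis of the stub read at height `s = 0`, using
  `‖Φ(x)‖ = √|P(x)|` for real `x`, `Φ(z) = ∏ⱼ √(z − eⱼ)` (`BoxReps.norm_Phi`) — so that Tonelli
  (`MeasureTheory.Integrable.mul_prod`) and the measure-preserving identification `ℝ² ≃ ℝ × ℝ`
  (`MeasureTheory.volume_preserving_finTwoArrow`) conclude.

Consequently the global representation `[(ℝ ∖ E)², f]` and the thirty-six boxes `[Jⱼ × Jₖ, f]`
over the gaps `J₀ = (−∞, e₀), J₁ = (e₀, e₁), …, J₅ = (e₄, ∞)` (rational endpoints, hence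
`ℚ`-semialgebraic cylinders) are Kontsevich–Zagier integral representations
(`KZ.IntegralRep 2`) whose integrand is literally `f`. No definitions are introduced.
References: Kontsevich–Zagier 2001, §1.1; Bochnak–Coste–Roy 1998, §2.2.
-/

noncomputable section

namespace Summit.KontsevichZagierPeriods.UnfoldedStokes.HyperellipticRiemannRelationLine

open Set MeasureTheory Filter Topology
open Literature.NumberTheory.Transcendental
open Literature.ModelTheory.ExponentialFields (IsSemialgebraic)

namespace BoxReps

/-! ## The modulus of `Φ` on the real axis -/

/-- `‖√w‖ = √‖w‖` for the principal complex square root `√w = w ^ (1/2)`. [folklore] -/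
theorem norm_csqrt (w : ℂ) : ‖Complex.sqrt w‖ = √‖w‖ := by
  rw [Complex.sqrt, Real.sqrt_eq_rpow, one_div]
  exact_mod_cast Complex.norm_cpow_inv_nat w 2

/-- On the real axis `‖Φ(x)‖ = √|P(x)|`, where `Φ(z) = ∏ⱼ √(z − eⱼ)` and `P(x) = ∏ⱼ (x − eⱼ)`.
[folklore] -/
theorem norm_Phi {e : Fin 5 → ℚ} {Φ : ℂ → ℂ}
    (hΦ : ∀ z, Φ z = ∏ j : Fin 5, Complex.sqrt (z - ((e j : ℝ) : ℂ))) (x : ℝ) :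
    ‖Φ (x : ℂ)‖ = √|∏ j : Fin 5, (x - (e j : ℝ))| := by
  rw [hΦ, norm_prod, Finset.abs_prod, Real.sqrt_prod _ (fun i _ => abs_nonneg _)]
  refine Finset.prod_congr rfl fun j _ => ?_
  rw [norm_csqrt, ← Complex.ofReal_sub, Complex.norm_real, Real.norm_eq_abs]

/-! ## Semialgebraic sets: the complement of the branch lines, and the boxes of the gap grid -/

/-- The complement `{x | ∀ j, x₀ ≠ eⱼ ∧ x₁ ≠ eⱼ}` of the ten branch lines is `ℚ`-semialgebraic:
it is the non-vanishing set of `P(x₀) P(x₁) ∈ ℚ[x₀, x₁]`. [folklore] -/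
theorem isSemialgebraic_offLines (e : Fin 5 → ℚ) :
    IsSemialgebraic ℚ {x : Fin 2 → ℝ | ∀ j, x 0 ≠ (e j : ℝ) ∧ x 1 ≠ (e j : ℝ)} := by
  have h := Literature.ModelTheory.ExponentialFields.isSemialgebraic_setOf_eval_ne_zero (k := ℚ)
    (R := ℝ) ((∏ j : Fin 5, (MvPolynomial.X 0 - MvPolynomial.C (e j))) *
      ∏ j : Fin 5, (MvPolynomial.X 1 - MvPolynomial.C (e j)) : MvPolynomial (Fin 2) ℚ)
  convert h using 1
  ext x
  simp [map_prod, Finset.prod_ne_zero_iff, sub_ne_zero, forall_and]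

/-- A left half-line with rational endpoint in one coordinate of `ℝ²` is `ℚ`-semialgebraic.
[folklore] -/
theorem isSemialgebraic_coord_mem_Iio (c : Fin 2) (a : ℚ) :
    IsSemialgebraic ℚ {x : Fin 2 → ℝ | x c ∈ Set.Iio (a : ℝ)} := by
  simpa using Literature.ModelTheory.ExponentialFields.isSemialgebraic_setOf_eval_lt (k := ℚ)
    (R := ℝ) (MvPolynomial.X c : MvPolynomial (Fin 2) ℚ) (MvPolynomial.C a)

/-- A right half-line with rational endpoint in one coordinate of `ℝ²` is `ℚ`-semialgebraic.
[folklore] -/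
theorem isSemialgebraic_coord_mem_Ioi (c : Fin 2) (a : ℚ) :
    IsSemialgebraic ℚ {x : Fin 2 → ℝ | x c ∈ Set.Ioi (a : ℝ)} := by
  simpa using Literature.ModelTheory.ExponentialFields.isSemialgebraic_setOf_eval_lt (k := ℚ)
    (R := ℝ) (MvPolynomial.C a : MvPolynomial (Fin 2) ℚ) (MvPolynomial.X c)

/-- An open interval with rational endpoints in one coordinate of `ℝ²` is `ℚ`-semialgebraic.
[folklore] -/
theorem isSemialgebraic_coord_mem_Ioo (c : Fin 2) (a b : ℚ) :
    IsSemialgebraic ℚ {x : Fin 2 → ℝ | x c ∈ Set.Ioo (a : ℝ) b} := by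
  convert (isSemialgebraic_coord_mem_Ioi c a).inter (isSemialgebraic_coord_mem_Iio c b) using 1
  ext x
  simp

/-- Each of the six gaps `J₀ = (−∞, e₀), J₁ = (e₀, e₁), …, J₅ = (e₄, ∞)`, read in one coordinate
of `ℝ²`, is a `ℚ`-semialgebraic cylinder. [folklore] -/
theorem isSemialgebraic_coord_mem_gap (e : Fin 5 → ℚ) (c : Fin 2) (j : Fin 6) :
    IsSemialgebraic ℚ {x : Fin 2 → ℝ | x c ∈ (![Set.Iio (e 0 : ℝ), Set.Ioo (e 0 : ℝ) (e 1 : ℝ),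
      Set.Ioo (e 1 : ℝ) (e 2 : ℝ), Set.Ioo (e 2 : ℝ) (e 3 : ℝ), Set.Ioo (e 3 : ℝ) (e 4 : ℝ),
      Set.Ioi (e 4 : ℝ)] : Fin 6 → Set ℝ) j} := by
  fin_cases j
  · simpa using isSemialgebraic_coord_mem_Iio c (e 0)
  · simpa using isSemialgebraic_coord_mem_Ioo c (e 0) (e 1)
  · simpa using isSemialgebraic_coord_mem_Ioo c (e 1) (e 2)
  · simpa using isSemialgebraic_coord_mem_Ioo c (e 2) (e 3)
  · simpa using isSemialgebraic_coord_mem_Ioo c (e 3) (e 4)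
  · simpa using isSemialgebraic_coord_mem_Ioi c (e 4)

/-- Every box `Jⱼ × Jₖ` of the gap grid is `ℚ`-semialgebraic. [folklore] -/
theorem isSemialgebraic_box (e : Fin 5 → ℚ) (j k : Fin 6) :
    IsSemialgebraic ℚ {x : Fin 2 → ℝ |
      x 0 ∈ (![Set.Iio (e 0 : ℝ), Set.Ioo (e 0 : ℝ) (e 1 : ℝ), Set.Ioo (e 1 : ℝ) (e 2 : ℝ),
        Set.Ioo (e 2 : ℝ) (e 3 : ℝ), Set.Ioo (e 3 : ℝ) (e 4 : ℝ), Set.Ioi (e 4 : ℝ)] :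
          Fin 6 → Set ℝ) j ∧
      x 1 ∈ (![Set.Iio (e 0 : ℝ), Set.Ioo (e 0 : ℝ) (e 1 : ℝ), Set.Ioo (e 1 : ℝ) (e 2 : ℝ),
        Set.Ioo (e 2 : ℝ) (e 3 : ℝ), Set.Ioo (e 3 : ℝ) (e 4 : ℝ), Set.Ioi (e 4 : ℝ)] :
          Fin 6 → Set ℝ) k} :=
  (isSemialgebraic_coord_mem_gap e 0 j).inter (isSemialgebraic_coord_mem_gap e 1 k)

/-! ## The integrand is semialgebraic -/

/-- The ordered product integrand `x₁ / √(|P(x₀)| |P(x₁)|)` is a `ℚ`-semialgebraic function on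
every `ℚ`-semialgebraic subset of `ℝ²` (coordinates and rational constants, closed under products,
`|·|`, `√·` and `(·)⁻¹`, junk values included; Bochnak–Coste–Roy 1998, Prop. 2.2.6 as proved in
the tree). [folklore] -/
theorem isSemialgebraicFunOn_integrand (e : Fin 5 → ℚ) {S : Set (Fin 2 → ℝ)}
    (hS : IsSemialgebraic ℚ S) :
    IsSemialgebraicFunOn ℚ S (fun x => x 1 /
      Real.sqrt (|∏ i : Fin 5, (x 0 - (e i : ℝ))| * |∏ i : Fin 5, (x 1 - (e i : ℝ))|)) := by
  have hX : ∀ c : Fin 2, IsSemialgebraicFunOn ℚ S (fun x => x c) := fun c => by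
    simpa using isSemialgebraicFunOn_aeval hS (MvPolynomial.X c : MvPolynomial (Fin 2) ℚ)
  have hP : ∀ c : Fin 2,
      IsSemialgebraicFunOn ℚ S (fun x => |∏ i : Fin 5, (x c - (e i : ℝ))|) := fun c =>
    (IsSemialgebraicFunOn.fun_finsetProd Finset.univ hS fun i _ =>
      (hX c).fun_sub (isSemialgebraicFunOn_const_ratCast hS (e i))).abs
  exact ((hX 1).fun_mul ((hP 0).fun_mul (hP 1)).fun_sqrt.fun_inv).congr fun x _ => by
    simp only [div_eq_mul_inv]

/-! ## The integrand is absolutely integrable on `ℝ²` -/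

/-- **Integrability.** If `‖Φ(x)⁻¹‖ ≤ C m(x)` and `‖x / Φ(x)‖ ≤ C m(x)` off the branch points,
with `m` integrable on `ℝ`, then `x₁ / √(|P(x₀)| |P(x₁)|) = (1/√|P(x₀)|) · (x₁/√|P(x₁)|)` is
absolutely integrable on `ℝ²`: each factor is measurable and dominated almost everywhere (the
branch set is finite, hence null) by `C m`, and the tensor product of two integrable functions
is integrable (Tonelli), transported along `ℝ² ≃ ℝ × ℝ`. [folklore] -/
theorem integrable_integrand {e : Fin 5 → ℚ} {Φ : ℂ → ℂ}
    (hΦ : ∀ z, Φ z = ∏ j : Fin 5, Complex.sqrt (z - ((e j : ℝ) : ℂ)))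
    {m : ℝ → ℝ} (hm : Integrable m) {C : ℝ}
    (hB : ∀ x : ℝ, (∀ j, x ≠ (e j : ℝ)) →
      ‖(Φ (x : ℂ))⁻¹‖ ≤ C * m x ∧ ‖(x : ℂ) / Φ (x : ℂ)‖ ≤ C * m x) :
    Integrable (fun x : Fin 2 → ℝ => x 1 /
      Real.sqrt (|∏ i : Fin 5, (x 0 - (e i : ℝ))| * |∏ i : Fin 5, (x 1 - (e i : ℝ))|)) := by
  have hPΦ : ∀ t : ℝ, ‖Φ (t : ℂ)‖ = √|∏ i : Fin 5, (t - (e i : ℝ))| := norm_Phi hΦ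
  -- almost every real number is off the finite branch set
  have hE : ∀ᵐ t : ℝ, ∀ j, t ≠ (e j : ℝ) := by
    have h0 : volume (Set.range fun j : Fin 5 => (e j : ℝ)) = 0 :=
      (Set.finite_range _).measure_zero volume
    filter_upwards [compl_mem_ae_iff.2 h0] with t ht
    exact fun j h => ht ⟨j, h.symm⟩
  -- the two one-variable factors are integrable on `ℝ`
  have hψ₀ : Integrable (fun t : ℝ => (√|∏ i : Fin 5, (t - (e i : ℝ))|)⁻¹) := by
    have hmeas : Measurable fun t : ℝ => (√|∏ i : Fin 5, (t - (e i : ℝ))|)⁻¹ := by fun_prop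
    refine (hm.const_mul C).mono' hmeas.aestronglyMeasurable ?_
    filter_upwards [hE] with t ht
    have h := (hB t ht).1
    rw [norm_inv, hPΦ] at h
    rwa [Real.norm_eq_abs, abs_of_nonneg (inv_nonneg.2 (Real.sqrt_nonneg _))]
  have hψ₁ : Integrable (fun t : ℝ => t / √|∏ i : Fin 5, (t - (e i : ℝ))|) := by
    have hmeas : Measurable fun t : ℝ => t / √|∏ i : Fin 5, (t - (e i : ℝ))| := by fun_prop
    refine (hm.const_mul C).mono' hmeas.aestronglyMeasurable ?_
    filter_upwards [hE] with t ht
    have h := (hB t ht).2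
    rw [norm_div, hPΦ, Complex.norm_real] at h
    rwa [Real.norm_eq_abs, abs_div, abs_of_nonneg (Real.sqrt_nonneg _), ← Real.norm_eq_abs]
  -- Tonelli on `ℝ × ℝ`, transported to `ℝ²` along `finTwoArrow`
  have key : (fun x : Fin 2 → ℝ => x 1 /
      Real.sqrt (|∏ i : Fin 5, (x 0 - (e i : ℝ))| * |∏ i : Fin 5, (x 1 - (e i : ℝ))|)) =
      (fun z : ℝ × ℝ => (√|∏ i : Fin 5, (z.1 - (e i : ℝ))|)⁻¹ *
        (z.2 / √|∏ i : Fin 5, (z.2 - (e i : ℝ))|)) ∘ ⇑(MeasurableEquiv.finTwoArrow) := by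
    funext x
    show _ = (√|∏ i : Fin 5, (x 0 - (e i : ℝ))|)⁻¹ * (x 1 / √|∏ i : Fin 5, (x 1 - (e i : ℝ))|)
    rw [Real.sqrt_mul (abs_nonneg _)]
    ring
  rw [key]
  exact (volume_preserving_finTwoArrow ℝ).integrable_comp_of_integrable (hψ₀.mul_prod hψ₁)

end BoxReps

/-- **Box representations.** The ordered product integrand `f(x₀,x₁) = x₁/√(|P(x₀)||P(x₁)|)` is
`ℚ`-semialgebraic off the branch lines and absolutely integrable on all of `ℝ²` (it is the product
`(1/√|P(x₀)|)·(x₁/√|P(x₁)|)` of two integrable functions of one variable: edge singularities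
`|x−eⱼ|^{−1/2}`, decay `|x|^{−5/2}`, `|x|^{−3/2}`; dominated via `stub_bounds` at height `0`), so
the global representation `[(ℝ\E)², f]` and every box `[Jⱼ×Jₖ, f]` exist. [folklore] -/
theorem stub_boxReps :
    ∀ (e : Fin 5 → ℚ), StrictMono e →
    ∀ (Φ : ℂ → ℂ), (∀ z, Φ z = ∏ j : Fin 5, Complex.sqrt (z - ((e j : ℝ) : ℂ))) →
    ∀ (m : ℝ → ℝ), (∀ x, m x =
        (1 + ∑ k : Fin 5, |x - (e k : ℝ)| ^ (-(3:ℝ) / 4)) * (1 + x ^ 2) ^ (-(5:ℝ) / 8)) →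
    (Integrable m ∧
      IntegrableOn (fun s : ℝ => (1 + s ^ (-(3:ℝ) / 4)) * (1 + s ^ 2) ^ (-(5:ℝ) / 8)) (Ioi 0) ∧
      IntegrableOn (fun s : ℝ => (1 + s ^ (-(3:ℝ) / 4)) * (1 + s ^ 2) ^ (-(5:ℝ) / 4)) (Ioi 0) ∧
      ∃ C : ℝ, 0 < C ∧ ∀ (x s : ℝ), 0 ≤ s → (∀ j, x ≠ (e j : ℝ)) →
        ‖(Φ ((x : ℂ) + (s : ℂ) * Complex.I))⁻¹‖ ≤ C * m x * (1 + s ^ 2) ^ (-(5:ℝ) / 8) ∧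
        ‖((x : ℂ) + (s : ℂ) * Complex.I) / Φ ((x : ℂ) + (s : ℂ) * Complex.I)‖ ≤
          C * m x * (1 + s ^ 2) ^ (-(1:ℝ) / 8) ∧
        (0 < s →
          ‖(Φ ((x : ℂ) + (s : ℂ) * Complex.I))⁻¹ *
              ∑ j : Fin 5, ((x : ℂ) + (s : ℂ) * Complex.I - ((e j : ℝ) : ℂ))⁻¹‖ ≤
            C * m x * (1 + s ^ (-(3:ℝ) / 4)) * (1 + s ^ 2) ^ (-(9:ℝ) / 8) ∧
          ‖(1 - ((x : ℂ) + (s : ℂ) * Complex.I) / 2 *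
                ∑ j : Fin 5, ((x : ℂ) + (s : ℂ) * Complex.I - ((e j : ℝ) : ℂ))⁻¹) /
              Φ ((x : ℂ) + (s : ℂ) * Complex.I)‖ ≤
            C * m x * (1 + s ^ (-(3:ℝ) / 4)) * (1 + s ^ 2) ^ (-(5:ℝ) / 8))) →
    ∀ (J : Fin 6 → Set ℝ), J = ![Set.Iio (e 0 : ℝ), Set.Ioo (e 0 : ℝ) (e 1 : ℝ),
        Set.Ioo (e 1 : ℝ) (e 2 : ℝ), Set.Ioo (e 2 : ℝ) (e 3 : ℝ), Set.Ioo (e 3 : ℝ) (e 4 : ℝ),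
        Set.Ioi (e 4 : ℝ)] →
    ∀ (f : (Fin 2 → ℝ) → ℝ), (∀ x, f x =
        x 1 / Real.sqrt (|∏ i : Fin 5, (x 0 - (e i : ℝ))| * |∏ i : Fin 5, (x 1 - (e i : ℝ))|)) →
    (∃ G₂ : KZ.IntegralRep 2,
        G₂.domain = {x | ∀ j, x 0 ≠ (e j : ℝ) ∧ x 1 ≠ (e j : ℝ)} ∧ G₂.integrand = f) ∧
    (∀ j k : Fin 6, ∃ p : KZ.IntegralRep 2,
        p.domain = {x | x 0 ∈ J j ∧ x 1 ∈ J k} ∧ p.integrand = f) := by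
  intro e _he Φ hΦ m _hm hbounds J hJ f hf
  obtain ⟨hm_int, -, -, C, -, hB⟩ := hbounds
  obtain rfl : f = fun x => x 1 /
      Real.sqrt (|∏ i : Fin 5, (x 0 - (e i : ℝ))| * |∏ i : Fin 5, (x 1 - (e i : ℝ))|) :=
    funext hf
  subst hJ
  -- the kernel bounds at height `s = 0`
  have hB0 : ∀ x : ℝ, (∀ j, x ≠ (e j : ℝ)) →
      ‖(Φ (x : ℂ))⁻¹‖ ≤ C * m x ∧ ‖(x : ℂ) / Φ (x : ℂ)‖ ≤ C * m x := by
    intro x hx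
    have h := hB x 0 le_rfl hx
    simp only [Complex.ofReal_zero, zero_mul, add_zero, ne_eq, OfNat.ofNat_ne_zero,
      not_false_eq_true, zero_pow, Real.one_rpow, mul_one] at h
    exact ⟨h.1, h.2.1⟩
  have hint := BoxReps.integrable_integrand hΦ hm_int hB0
  refine ⟨⟨⟨{x | ∀ j, x 0 ≠ (e j : ℝ) ∧ x 1 ≠ (e j : ℝ)}, _, BoxReps.isSemialgebraic_offLines e,
      BoxReps.isSemialgebraicFunOn_integrand e (BoxReps.isSemialgebraic_offLines e),
      hint.integrableOn⟩, rfl, rfl⟩, fun j k => ?_⟩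
  exact ⟨⟨_, _, BoxReps.isSemialgebraic_box e j k,
    BoxReps.isSemialgebraicFunOn_integrand e (BoxReps.isSemialgebraic_box e j k),
    hint.integrableOn⟩, rfl, rfl⟩

end Summit.KontsevichZagierPeriods.UnfoldedStokes.HyperellipticRiemannRelationLine
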